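import Summits.BirchSwinnertonDyer.Rank1Residual.GaloisImage.KolyvaginStubVanishing
import Summits.BirchSwinnertonDyer.Rank1Residual.GaloisImage.SakamotoN11InstanceLevelOneLocal
import Summits.BirchSwinnertonDyer.Rank1Residual.GaloisImage.SakamotoN11InstanceResidual
import Summits.BirchSwinnertonDyer.Rank1Residual.GaloisImage.PrimeChoiceSakamotoTorsion
import Summits.BirchSwinnertonDyer.Rank1Residual.GaloisImage.KolyvaginPrimeLocalShapeRatHolds
import Summits.BirchSwinnertonDyer.Rank1Residual.GaloisImage.CanonicalKolyvaginDatumAdmissible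
import Summits.BirchSwinnertonDyer.Rank1Residual.X11b.WeilTransport
import HarnessLib

/-!
# Stub vanishing at `m = 1` for `E[p]` over `ℚ`, every binder but the certificate discharged —
# and the N11 level-one reading: `κ_d ≠ 0 ⟹ #H¹_{𝓕̄_can(d)^*}(ℚ, E[3]^∨(1)) = 1` and
# `κ_1 ≠ 0 ⟹ #H¹_{𝓕̄_can}(ℚ, E[3]) = 3` WITHOUT the two [S24] named facts
# (cell `b2b-bsdres`, team n1011, ROUTE-1 item R1-56 sub-item K6; row T-R1-56-K6, seat p09 GEN 6;
# file 3 of the row; skeleton `cells/n1011/skel/T-R1-56-K6.md`)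

HONEST FRAMING (cell `b2b-bsdres`, run/shared/lean/b2b/bsd-rank1-residual/, verbatim in every
file): the goal of the cell is to DELETE the COMBINATION-SHAPED residual classes of the
Birch–Swinnerton-Dyer formula for ALL analytic-rank `≤ 1` elliptic curves over `ℚ` — "full BSD
formula for every rank `≤ 1` curve in class `C`" assembled STRICTLY from published theorems — so
that the rank-`≤ 1` remainder becomes exactly the CONSTRUCTION-SHAPED classes, which are TYPED
(missing-input `Prop`s), NOT attempted. This is not "finishing BSD". Team n1011 (N10/N11, the
additive block `X4 ∧ p = 3`): research route; TOOL theorems, no class theorem; the label X4 and the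
mark of RESIDUAL-MAP §I N11 are UNCHANGED by this file; nothing is booked. Theorems only: no
definition, no named fact, no `sorry`.

## What and why

File 1 (`KolyvaginStubVanishing`, Mazur–Rubin Thm. 4.3.4 / Rubin PCMI Thm. 2.8.4 at `m = 1`, any core
rank): a Kolyvagin system `κ ∈ KS₁(T̄, 𝓕, 𝒫)` has `κ_d = 0` wherever `H¹_{𝓕(d)^*} ≠ 0`, modulo the
prime choice, the local shape at the Kolyvagin primes and admissibility.  For `T̄ = E[p]` over `ℚ`
(`p` odd, `ρ̄_{E,p}` onto, `𝒫 = 𝒫(τ)` Sakamoto's `τ`-class primes, the cyclotomic transverse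
conditions) ALL of these are tree theorems:
* the prime choice = Sakamoto, JTNB 36 (2024) Cor. 5.5 = n1011-p15's
  `PrimeChoice.hC55_of_hasSurjectiveModNGaloisRep` (T-C55K), the dual class transported by the inverse
  Weil map `X11b.LocBridge.weilDualInv` (n1011-p11's `CoreRankZero.…_of_selfDual` pattern);
* `#H¹_tr(ℚ_𝔮, E[p]) = p`, `H¹ = H¹_ur + H¹_tr` = n1011-p18's T-R1-16-LOC ℚ-readings
  `natCard_transverse_rat_of_primes_eq_of_smul_eq_zero'`,
  `unramifiedSubgroup_sup_transverse_eq_top_rat_of_primes_eq_of_smul_eq_zero'`.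

* §1 `CoreRankZero.torsion_dualSelmerGroup_atLevel_eq_bot_of_apply_ne_zero_rat` — for ANY Selmer
  structure `𝓕` on `E[p]` (finite Selmer and dual Selmer groups, unramified outside an admissible
  `S`) and any admissible datum on `𝒫(τ)`: `κ_d ≠ 0 ⟹ H¹_{𝓕(d)^*}(ℚ, E[p]^∨(1)) = 0`.
* §2 the N11 reading at level one (`p = 3`, `𝓕 = 𝓕̄_can = propagatedSelmerStructureOne W 3`, THE
  canonical comparison maps): `natCard_dualSelmerGroup_atLevel_eq_one_of_apply_ne_zero_noS24` — SAME
  conclusion as n1011-p13's `dualSelmerGroup_natCard_eq_one_propagatedSelmerStructureOne_of_apply_ne_zero`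
  (`KolyvaginLevelOneUnitCase`, which derives it from [S24] Thm. 4.4 (1) `hS24` AND (2) `hS24₂`),
  binders = p13's MINUS `hS24`, `hS24₂`, `hunro`, the second family `inv'`; and
  `natCard_selmerGroup_propagatedSelmerStructureOne_eq_three_of_apply_empty_ne_zero_noS24` — SAME
  conclusion `#H¹_{𝓕̄_can}(ℚ, E[3]) = 3` as p13's
  `natCard_selmerGroup_propagatedSelmerStructureOne_eq_three_of_apply_empty_ne_zero`, from the core
  rank `χ(𝓕̄_can) = 1` (n1011-p13/p04: `hasCoreRank_one_propagatedSelmerStructureOne_of_isPerfect_of_localEuler`,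
  a theorem modulo `hEP`) and §1 at `d = 1` — NO Kolyvagin-system structure theorem is used.
  Finiteness of `H¹_{𝓕̄_can}` is Silverman X.4.2 (b) through the Kummer comparison off `3`
  (`CoreRankZero.finite_selmerGroup_of_le_off`), of its dual by the core-rank count.

What is NOT here: the certificate `κ` (Kato's Kolyvagin system with a `3`-unit bottom class — the
typed located gap of row T-a5x, unchanged); the END theorems `Sel₃ = 0` / `BSD(E, 3)` without the
[S24] facts (next file `KolyvaginLevelOneUnitCaseNoS24`); any class theorem.

References: [Rubin2011] Thm. 2.8.4 (p. 25), Prop. 2.7.1 (p. 23), Prop. 1.9.5 (p. 16); [MazurRubin2004]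
Thm. 4.3.4 (p. 45), Lemma 1.2.3; [Sakamoto2024] §2 (p. 921), Def. 3.6 (p. 923), Thm. 4.4 (p. 926),
Cor. 5.5 (p. 929); [SilvermanAEC2009] Thm. X.4.2 (b), Prop. III.8.1; [MilneADT2006] I Thm. 2.8.
-/

noncomputable section

open scoped Classical NumberField ContRepresentation
open Function Field NumberField IsDedekindDomain WeierstrassCurve
open Literature.NumberTheory.EllipticCurves
open Literature.NumberTheory.GaloisRepresentations Literature.NumberTheory.GaloisRepresentations.DiscreteGaloisModule
  Literature.NumberTheory.GaloisCohomology

namespace Summit.BirchSwinnertonDyer.Rank1Residual.GaloisImage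

open Summit.BirchSwinnertonDyer.Rank1Residual.X11b.LocBridge

/-! ## §1. `E[p]` over `ℚ`: `κ_d ≠ 0 ⟹ H¹_{𝓕(d)^*} = 0`, local shape and prime choice discharged -/

namespace CoreRankZero

/-- **`κ_d ≠ 0 ⟹ H¹_{𝓕(d)^*}(ℚ, E[p]^∨(1)) = 0` for `E[p]` over `ℚ`, `p` odd, `ρ̄_{E,p}` onto.**
`𝓕` is ANY Selmer structure on `E[p]` unramified outside the finite `S ⊇ ∞ ∪ {p} ∪ Ram(E[p])` with
finite Selmer and dual Selmer groups (for a Poitou–Tate family `inv`), `D` a Kolyvagin datum on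
Sakamoto's primes `𝒫(τ) = frobeniusClassPrimes ρ {v | v ∈ S} τ p` (`τ ∈ Γ_{ℚ(μ_p)}`,
`E[p]/(τ−1)E[p] ≅ ℤ/p`) with the cyclotomic transverse conditions and admissible comparison maps,
`κ ∈ KS₁(E[p], 𝓕, 𝒫(τ))` with `κ_d ≠ 0`.  File 1's `dualSelmerGroup_atLevel_eq_bot_of_apply_ne_zero`
(Rubin Thm. 2.8.4 at `m = 1`) with: the local shape by n1011-p18's T-R1-16-LOC ℚ-readings; the prime
choice by Sakamoto's Cor. 5.5 = n1011-p15's `PrimeChoice.hC55_of_hasSurjectiveModNGaloisRep`, the dual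
class transported along the inverse Weil map (injective on `H¹`: `map_weilDual_map_weilDualInv`).
Remaining binders: the Poitou–Tate family, `hS`/`h𝓕`/`hfin`/`hfind`, the datum's `hP hT hτ hτμ hadm`.
[cite: Rubin2011, Thm. 2.8.4 (p. 25) and Prop. 2.7.1 (p. 23)] [cite: Sakamoto2024, Cor. 5.5 (p. 929)]
[cite: SilvermanAEC2009, Prop. III.8.1] -/
theorem torsion_dualSelmerGroup_atLevel_eq_bot_of_apply_ne_zero_rat (W : WeierstrassCurve ℚ)
    [W.IsElliptic] (p : ℕ) [Fact p.Prime] (hp2 : p ≠ 2) [Finite (geomTorsion W (p : ℤ))]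
    (hsurj : W.HasSurjectiveModNGaloisRep (p : ℤ))
    {inv : LocalInvariants ℚ p}
    (hperf : inv.IsPerfect) (hsum : inv.SumLocalTermEqZero) (hcompl : inv.SelmerComplement)
    {S : Finset (Place ℚ)}
    (hS : ∀ v : HeightOneSpectrum (𝓞 ℚ), (Sum.inr v : Place ℚ) ∉ S →
      ((p : ℕ) : 𝓞 ℚ) ∉ v.asIdeal ∧ GaloisRep.IsUnramifiedAt v (W.torsionGaloisModule (p : ℤ)))
    {𝓕 : SelmerStructure (W.torsionGaloisModule (p : ℤ))} (h𝓕 : 𝓕.IsUnramifiedOutside S)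
    (hfin : Finite 𝓕.selmerGroup)
    (hfind : Finite (inv.dualSelmerStructure (W.torsionGaloisModule (p : ℤ)) 𝓕).selmerGroup)
    {D : KolyvaginDatum (W.torsionGaloisModule (p : ℤ))} {τ : absoluteGaloisGroup ℚ}
    (hP : D.primes = frobeniusClassPrimes (W.torsionGaloisModule (p : ℤ))
      {v | (Sum.inr v : Place ℚ) ∈ S} τ p)
    (hT : D.transverse = cyclotomicTransverse (W.torsionGaloisModule (p : ℤ)))
    (hτ : Nonempty (cokerSubOne (W.torsionGaloisModule (p : ℤ)) τ ≃+ ZMod p))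
    (hτμ : τ ∈ rootsOfUnityFixer ℚ p)
    (hadm : D.IsAdmissible)
    {κ : Finset (HeightOneSpectrum (𝓞 ℚ)) → galoisCohomology (W.torsionGaloisModule (p : ℤ)) 1}
    (hκ : D.IsKolyvaginSystem 𝓕 κ) {d : Finset (HeightOneSpectrum (𝓞 ℚ))} (hd : D.IsLevel d)
    (hκd : κ d ≠ 0) :
    (inv.dualSelmerStructure (W.torsionGaloisModule (p : ℤ)) (D.atLevel 𝓕 d)).selmerGroup = ⊥ := by
  have hp : p.Prime := Fact.out
  haveI : NeZero p := ⟨hp.ne_zero⟩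
  obtain ⟨e, hμ, hadd₁, hadd₂, -, hnondeg, hgal⟩ :=
    exists_weilPairing_holds W p hp.two_le (Nat.cast_ne_zero.2 hp.ne_zero)
  -- `E[p]` is killed by `p`
  have hM : ∀ m : geomTorsion W (p : ℤ), p • m = 0 := fun T => AddSubgroup.torsionBy.nsmul T
  -- the primes of `𝒫(τ)` lie outside `S` (definition of `frobeniusClassPrimes`)
  have hPS : ∀ q ∈ D.primes, (Sum.inr q : Place ℚ) ∉ S := by
    intro q hq
    rw [hP] at hq
    exact hq.1
  -- the local shape at the Kolyvagin primes (n1011-p18, T-R1-16-LOC)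
  have hT' := natCard_transverse_rat_of_primes_eq_of_smul_eq_zero' (W.torsionGaloisModule (p : ℤ))
    hP hT hτ hτμ hM
  have hUT := unramifiedSubgroup_sup_transverse_eq_top_rat_of_primes_eq_of_smul_eq_zero'
    (W.torsionGaloisModule (p : ℤ)) hP hT hτμ hM
  -- the prime choice: Sakamoto Cor. 5.5 (n1011-p15) on three classes of `H¹(ℚ, E[p])`, the dual
  -- class transported by the inverse Weil map (injective on `H¹`)
  have hC55 := PrimeChoice.hC55_of_hasSurjectiveModNGaloisRep W p hp2 hsurj hP hτ
  have hθ' : Injective (galoisCohomology.map (weilDualInv W p e hμ hadd₁ hadd₂ hgal hnondeg) 1) := by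
    intro y y' h
    have h' := congrArg (galoisCohomology.map (weilDualIntertwining W p e hμ hadd₁ hadd₂ hgal) 1) h
    rwa [map_weilDual_map_weilDualInv, map_weilDual_map_weilDualInv] at h'
  refine dualSelmerGroup_atLevel_eq_bot_of_apply_ne_zero hperf hsum hcompl hM hS h𝓕 hfin hfind hPS
    hadm hT' hUT (fun d _ c _ c' _ hc hc' => ?_) hκ hd hκd
  -- from `hC55` to the level-wise prime choice (p11's `…_of_selfDual` / `…_of_infinite` steps)
  have hc'' : galoisCohomology.map (weilDualInv W p e hμ hadd₁ hadd₂ hgal hnondeg) 1 c' ≠ 0 :=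
    fun h => hc' (hθ' (by rw [h, map_zero]))
  have hinf : {q ∈ D.primes |
      galoisCohomology.localization (W.torsionGaloisModule (p : ℤ)) (Sum.inr q) 1 c ≠ 0 ∧
      galoisCohomology.localization ((W.torsionGaloisModule (p : ℤ)).tateDual p) (Sum.inr q) 1 c' ≠ 0}.Infinite := by
    refine (hC55 c _ _ hc hc'' hc'').mono fun q hq => ⟨hq.1, hq.2.1, fun h0 => hq.2.2.1 ?_⟩
    rw [localization_map_one_eq, h0]
    exact map_zero _
  obtain ⟨q, ⟨hq, hcq, hc'q⟩, hqd⟩ := hinf.exists_notMem_finset d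
  exact ⟨q, hq, hqd, hcq, hc'q⟩

end CoreRankZero

/-! ## §2. The N11 reading at level one: `(E[3], 𝓕̄_can)`, THE canonical comparison maps -/

variable (W : WeierstrassCurve ℚ) [W.IsElliptic]

/-- **`H¹_{𝓕̄_can}(ℚ, E[3])` is finite** (no hypothesis beyond ellipticity): off the place `3` the
residual canonical structure IS the `3`-descent (Kummer) structure (n1011-p06
`propagatedSelmerStructureOne_inr_eq_kummerSelmerStructure` with n1011-p05's bounded exponent),
at the infinite place `H¹(ℝ, E[3]) = 0` (odd `3`), and `Sel^{(3)}(E/ℚ)` is finite (Silverman X.4.2 (b),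
`finite_selmerGroup_holds`); finiteness transfers along structures agreeing off one place (p11's
`CoreRankZero.finite_selmerGroup_of_le_off`). [cite: SilvermanAEC2009, Thm X.4.2(b)] -/
theorem finite_selmerGroup_propagatedSelmerStructureOne_three [Finite (geomTorsion W ((3 : ℕ) : ℤ))] :
    Finite (propagatedSelmerStructureOne W 3).selmerGroup := by
  haveI : Fact (Nat.Prime 3) := ⟨Nat.prime_three⟩
  have hKfin : Finite (W.kummerSelmerStructure ((3 : ℕ) : ℤ)).selmerGroup := by
    rw [← selmerGroup_eq_selmerGroup_kummerSelmerStructure]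
    exact W.finite_selmerGroup_holds (by norm_num)
  refine CoreRankZero.finite_selmerGroup_of_le_off
    {(Rat.HeightOneSpectrum.primesEquiv (R := 𝓞 ℚ)).symm ⟨3, Nat.prime_three⟩}
    (fun v hv => le_of_eq ?_) hKfin
  rcases v with w | v
  · -- at the infinite place both conditions live in `H¹(ℝ, E[3]) = 0` (odd `3`)
    have h0 : ∀ x : galoisCohomology ((W.torsionGaloisModule ((3 : ℕ) : ℤ)).toLocal (Sum.inl w)) 1,
        x = 0 := fun x =>
      galoisCohomology_one_torsion_eq_zero_infinitePlace_of_odd W w ⟨1, by norm_num⟩ x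
    ext x
    rw [h0 x]
    exact ⟨fun _ => zero_mem _, fun _ => zero_mem _⟩
  · have h3v : ((3 : ℕ) : 𝓞 ℚ) ∉ v.asIdeal := fun h =>
      hv _ (Finset.mem_singleton_self _)
        (congrArg Sum.inr (heightOneSpectrum_eq_of_three_mem h three_mem_primesEquiv_symm_three))
    exact propagatedSelmerStructureOne_inr_eq_kummerSelmerStructure W 3 v h3v
      (bounded_pPrimaryTorsion_localGaloisModule_rat W 3 h3v)

/-- **The dual Selmer group `H¹_{𝓕̄_can^*}(ℚ, E[3]^∨(1))` is finite**, from the core rank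
`#H¹_{𝓕̄_can} = 3 · #H¹_{𝓕̄_can^*}` (n1011-p13's `hasCoreRank_one_propagatedSelmerStructureOne`, all
its inputs discharged from `hEP` by `…_of_isPerfect_of_localEuler`) and the finiteness of
`H¹_{𝓕̄_can}`. [cite: Sakamoto2024, Def. 3.6 (p. 923)] [cite: MilneADT2006, Ch. I, Thm. 2.8] -/
theorem finite_dualSelmerGroup_propagatedSelmerStructureOne_three [Finite (geomTorsion W ((3 : ℕ) : ℤ))]
    (inv : LocalInvariants ℚ 3) (hperf : inv.IsPerfect) (hsum : inv.SumLocalTermEqZero)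
    (hcompl : inv.SelmerComplement)
    (hEP : ∀ v : HeightOneSpectrum (𝓞 ℚ), localEulerPoincareCharacteristic (v.adicCompletion ℚ))
    (T : Finset (HeightOneSpectrum (𝓞 ℚ)))
    (h3T : ∀ v : HeightOneSpectrum (𝓞 ℚ), ((3 : ℕ) : 𝓞 ℚ) ∈ v.asIdeal → v ∈ T)
    (hbadT : ∀ v : HeightOneSpectrum (𝓞 ℚ), ¬ W.HasGoodReductionAt v → v ∈ T) :
    Finite (inv.dualSelmerStructure (W.torsionGaloisModule ((3 : ℕ) : ℤ))
      (propagatedSelmerStructureOne W 3)).selmerGroup := by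
  have hχ := hasCoreRank_one_propagatedSelmerStructureOne_of_isPerfect_of_localEuler W inv hperf hsum
    hcompl hEP T h3T hbadT
  haveI := finite_selmerGroup_propagatedSelmerStructureOne_three W
  rw [LocalInvariants.HasCoreRank, pow_one] at hχ
  refine Nat.finite_of_card_ne_zero fun h0 => ?_
  have h : Nat.card (propagatedSelmerStructureOne W 3).selmerGroup = 0 := by rw [hχ, h0, mul_zero]
  exact Nat.card_pos.ne' h

/-- **Level-one certificate ⟹ dual Selmer vanishing on `(E[3], 𝓕̄_can)` WITHOUT the [S24] facts.**
SAME conclusion as n1011-p13's `dualSelmerGroup_natCard_eq_one_propagatedSelmerStructureOne_of_apply_ne_zero`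
(`KolyvaginLevelOneUnitCase`): if SOME Kolyvagin system `κ ∈ KS₁(E[3], 𝓕̄_can, 𝒫(τ))` has
`κ_d ≠ 0` at a level `d`, then `#H¹_{𝓕̄_can(d)^*}(ℚ, E[3]^∨(1)) = 1`.  There it was "two lines over
[S24] Thm. 4.4 (1) `hS24` + (2) `hS24₂`"; here it is Mazur–Rubin Thm. 4.3.4 / Rubin Thm. 2.8.4 at
`m = 1` (file 1 + §1), a THEOREM: binders = p13's MINUS `hS24`, `hS24₂`, `hunro`, the second family
`inv'` (state it for the one family whose dual is measured).  Kept: `[Finite E[3]]`, surj(3), the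
`τ`-datum, `inv` ×3, `hEP` (finiteness of the dual Selmer group via the core-rank count; (Lp) from
it, p04 T-Lp), the admissible `S`, the datum `D η hP hT hD` (admissibility from THE canonical maps:
n1011-p04's `FSComp.isAdmissible_of_hasCanonicalComparison_frobeniusClassPrimes`), `d`, the
certificate `κ`, `hκ`.  No tower: every surj(3) row incl. EXOTIC.  Nothing booked; no mark changed.
[cite: Rubin2011, Thm. 2.8.4 (p. 25)] [cite: MazurRubin2004, Thm. 4.3.4 (p. 45) and Lemma 1.2.3]
[cite: Sakamoto2024, Cor. 5.5 (p. 929)] -/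
theorem natCard_dualSelmerGroup_atLevel_eq_one_of_apply_ne_zero_noS24
    [Finite (geomTorsion W ((3 : ℕ) : ℤ))]
    (h3 : W.HasSurjectiveModNGaloisRep ((3 : ℕ) : ℤ))
    (τ : absoluteGaloisGroup ℚ) (hτμ : τ ∈ rootsOfUnityFixer ℚ 3)
    (hτq : Nonempty (cokerSubOne (W.torsionGaloisModule ((3 : ℕ) : ℤ)) τ ≃+ ZMod 3))
    (inv : LocalInvariants ℚ 3) (hperf : inv.IsPerfect) (hsum : inv.SumLocalTermEqZero)
    (hcompl : inv.SelmerComplement)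
    (hEP : ∀ v : HeightOneSpectrum (𝓞 ℚ), localEulerPoincareCharacteristic (v.adicCompletion ℚ))
    (S : Finset (Place ℚ)) (hS : ∀ w : InfinitePlace ℚ, (Sum.inl w : Place ℚ) ∈ S)
    (h3S : ∀ v : HeightOneSpectrum (𝓞 ℚ), ((3 : ℕ) : 𝓞 ℚ) ∈ v.asIdeal → (Sum.inr v : Place ℚ) ∈ S)
    (hbadS : ∀ v : HeightOneSpectrum (𝓞 ℚ), ¬ W.HasGoodReductionAt v → (Sum.inr v : Place ℚ) ∈ S)
    (D : KolyvaginDatum (W.torsionGaloisModule ((3 : ℕ) : ℤ)))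
    (η : (q : HeightOneSpectrum (𝓞 ℚ)) → (ZMod (Ideal.absNorm q.asIdeal))ˣ)
    (hP : D.primes = frobeniusClassPrimes (W.torsionGaloisModule ((3 : ℕ) : ℤ))
      {v | (Sum.inr v : Place ℚ) ∈ S} τ 3)
    (hT : D.transverse = cyclotomicTransverse (W.torsionGaloisModule ((3 : ℕ) : ℤ)))
    (hD : D.HasCanonicalComparison 3 η)
    (d : Finset (HeightOneSpectrum (𝓞 ℚ))) (hd : D.IsLevel d)
    (κ : D.kolyvaginSystems (propagatedSelmerStructureOne W 3)) (hκ : κ.1 d ≠ 0) :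
    Nat.card (inv.dualSelmerStructure (W.torsionGaloisModule ((3 : ℕ) : ℤ))
        (D.atLevel (propagatedSelmerStructureOne W 3) d)).selmerGroup = 1 := by
  haveI : Fact (Nat.Prime 3) := ⟨Nat.prime_three⟩
  haveI : Module.Finite (ZMod 3) (geomTorsion W ((3 : ℕ) : ℤ)) := Module.Finite.of_finite
  -- the finite places of `S`
  let T : Finset (HeightOneSpectrum (𝓞 ℚ)) := S.preimage Sum.inr Sum.inr_injective.injOn
  have h3T : ∀ v : HeightOneSpectrum (𝓞 ℚ), ((3 : ℕ) : 𝓞 ℚ) ∈ v.asIdeal → v ∈ T :=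
    fun v hv => Finset.mem_preimage.mpr (h3S v hv)
  have hbadT : ∀ v : HeightOneSpectrum (𝓞 ℚ), ¬ W.HasGoodReductionAt v → v ∈ T :=
    fun v hv => Finset.mem_preimage.mpr (hbadS v hv)
  -- finiteness of the Selmer group and of its dual; admissibility of THE canonical maps
  have hfin := finite_selmerGroup_propagatedSelmerStructureOne_three W
  have hfind := finite_dualSelmerGroup_propagatedSelmerStructureOne_three W inv hperf hsum hcompl hEP T
    h3T hbadT
  have hadm : D.IsAdmissible :=
    FSComp.isAdmissible_of_hasCanonicalComparison_frobeniusClassPrimes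
      (W.torsionGaloisModule ((3 : ℕ) : ℤ)) 3 {v | (Sum.inr v : Place ℚ) ∈ S} hτq hτμ hP hD
  rw [CoreRankZero.torsion_dualSelmerGroup_atLevel_eq_bot_of_apply_ne_zero_rat W 3 (by decide) h3 hperf
    hsum hcompl (fun v hv => not_mem_and_isUnramifiedAt_three_of_not_mem W S h3S hbadS hv)
    (propagatedSelmerStructureOne_three_isUnramifiedOutside W S hS h3S hbadS) hfin hfind hP hT hτq hτμ
    hadm ((KolyvaginDatum.mem_kolyvaginSystems_iff D _ κ.1).mp κ.2) hd hκ, AddSubgroup.card_bot]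

/-- **Level-one certificate ⟹ `#H¹_{𝓕̄_can}(ℚ, E[3]) = 3` WITHOUT the [S24] facts.**  SAME
conclusion as n1011-p13's `natCard_selmerGroup_propagatedSelmerStructureOne_eq_three_of_apply_empty_ne_zero`
(there: `λ*(∅) = 0` by the previous step, then the bijectivity clause of [S24] Thm. 4.4 (1) and
`KS₁ ≅ 𝔽₃`); here: `#H¹_{𝓕̄_can} = 3 · #H¹_{𝓕̄_can^*}` (the core rank `χ(𝓕̄_can) = 1`, a theorem modulo
`hEP`: `hasCoreRank_one_propagatedSelmerStructureOne_of_isPerfect_of_localEuler`) and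
`#H¹_{𝓕̄_can^*} = 1` (previous theorem at `d = ∅`).  Binders = p13's MINUS `hS24`, `hS24₂`, `hunro`.
[cite: Rubin2011, Thm. 2.8.4 (p. 25) and Ex. 2.5.4 (2) (p. 21)] [cite: Sakamoto2024, Def. 3.6 (p. 923)] -/
theorem natCard_selmerGroup_propagatedSelmerStructureOne_eq_three_of_apply_empty_ne_zero_noS24
    [Finite (geomTorsion W ((3 : ℕ) : ℤ))]
    (h3 : W.HasSurjectiveModNGaloisRep ((3 : ℕ) : ℤ))
    (τ : absoluteGaloisGroup ℚ) (hτμ : τ ∈ rootsOfUnityFixer ℚ 3)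
    (hτq : Nonempty (cokerSubOne (W.torsionGaloisModule ((3 : ℕ) : ℤ)) τ ≃+ ZMod 3))
    (inv : LocalInvariants ℚ 3) (hperf : inv.IsPerfect) (hsum : inv.SumLocalTermEqZero)
    (hcompl : inv.SelmerComplement)
    (hEP : ∀ v : HeightOneSpectrum (𝓞 ℚ), localEulerPoincareCharacteristic (v.adicCompletion ℚ))
    (S : Finset (Place ℚ)) (hS : ∀ w : InfinitePlace ℚ, (Sum.inl w : Place ℚ) ∈ S)
    (h3S : ∀ v : HeightOneSpectrum (𝓞 ℚ), ((3 : ℕ) : 𝓞 ℚ) ∈ v.asIdeal → (Sum.inr v : Place ℚ) ∈ S)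
    (hbadS : ∀ v : HeightOneSpectrum (𝓞 ℚ), ¬ W.HasGoodReductionAt v → (Sum.inr v : Place ℚ) ∈ S)
    (D : KolyvaginDatum (W.torsionGaloisModule ((3 : ℕ) : ℤ)))
    (η : (q : HeightOneSpectrum (𝓞 ℚ)) → (ZMod (Ideal.absNorm q.asIdeal))ˣ)
    (hP : D.primes = frobeniusClassPrimes (W.torsionGaloisModule ((3 : ℕ) : ℤ))
      {v | (Sum.inr v : Place ℚ) ∈ S} τ 3)
    (hT : D.transverse = cyclotomicTransverse (W.torsionGaloisModule ((3 : ℕ) : ℤ)))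
    (hD : D.HasCanonicalComparison 3 η)
    (κ : D.kolyvaginSystems (propagatedSelmerStructureOne W 3)) (hκ : κ.1 ∅ ≠ 0) :
    Nat.card (propagatedSelmerStructureOne W 3).selmerGroup = 3 := by
  let T : Finset (HeightOneSpectrum (𝓞 ℚ)) := S.preimage Sum.inr Sum.inr_injective.injOn
  have h3T : ∀ v : HeightOneSpectrum (𝓞 ℚ), ((3 : ℕ) : 𝓞 ℚ) ∈ v.asIdeal → v ∈ T :=
    fun v hv => Finset.mem_preimage.mpr (h3S v hv)
  have hbadT : ∀ v : HeightOneSpectrum (𝓞 ℚ), ¬ W.HasGoodReductionAt v → v ∈ T :=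
    fun v hv => Finset.mem_preimage.mpr (hbadS v hv)
  have hχ := hasCoreRank_one_propagatedSelmerStructureOne_of_isPerfect_of_localEuler W inv hperf hsum
    hcompl hEP T h3T hbadT
  have hN := natCard_dualSelmerGroup_atLevel_eq_one_of_apply_ne_zero_noS24 W h3 τ hτμ hτq inv hperf hsum
    hcompl hEP S hS h3S hbadS D η hP hT hD ∅ D.isLevel_empty κ hκ
  have h0 : D.atLevel (propagatedSelmerStructureOne W 3) ∅ = propagatedSelmerStructureOne W 3 :=
    SelmerStructure.modify_empty _ D.transverse
  rw [h0] at hN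
  rw [LocalInvariants.HasCoreRank, pow_one, hN, mul_one] at hχ
  exact hχ

end Summit.BirchSwinnertonDyer.Rank1Residual.GaloisImage

end
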